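import Summits.BirchSwinnertonDyer.BirchSwinnertonDyer.Theorems.ResidualThetaTransportAtTwoThetaLayerLambdaCongruenceAtTwoNonRootOfDeligne
import HarnessLib

/-!
# Split certificate for crux `ThetaLayerLambdaCongruenceAtTwo` (stmt-BirchSwinnertonDyer-20688), skeleton v9
# (lead prover bsd-wall-rtt-p3 g3, 2026-08-28) — child texts in ROUTE-FILE SPELLING + kernel certificate

For the pen (director-bsd W-65 (b): «C3 enters only as split children, glue proved first»). The three children below are
the registered stubs of `Lines/birth.lean` v9 (`bf66d46ddfb7257a`) with the route-file spelling (no scoped `SL(2, ℤ)`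
notation: `Matrix.SpecialLinearGroup (Fin 2) ℤ`; every Literature name fully qualified; no `open`). The `example`s are
the certificates: each child text is definitionally the registered stub, and child₁ → child₂ → child₃ → crux BY NAME is
the landed theorem `…Theorems.ThetaLayerLambdaCongruenceAtTwo.thetaLayerLambdaCongruenceAtTwo_of_charTwo_curveMax_deligne`
(p592986, over p591743 `…SplitGlue`, p589929 `…ResidualReduction`, p591600 `…LevelCoeffBound`). Route-file import needed
for child 3: `Literature.NumberTheory.EllipticCurves.DeligneHeckeEigenvalueBound` (already under `import Mathlib`? no —
it is a Literature module; the Theorems import above brings it). Suggested kinds: child 1 support (known mathematics,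
XL formalisation; or crux), child 2 crux (research: μ of W at 2), child 3 support/PUB-alias HELD (printed named fact).
BSD is not proved by any of this.
-/

-- justification: route-file convention
set_option linter.dupNamespace false

-- the route file `Theses/ResidualThetaTransportAtTwo.lean` has `open scoped … Classical …` (needed by child 2's
-- `Fintype.piFinset`/`∏ v : S₀`: `DecidableEq ↥S₀`); nothing else of its `open`s is used by the texts below
open scoped Classical

namespace Summit.BirchSwinnertonDyer.BirchSwinnertonDyer.Cruxes.ThetaLayerLambdaCongruenceAtTwo.SplitV9

/-- Child 1 (C3k) `PlusLineCharTwo` — route spelling of `stub_plusLineCharTwo`. -/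
def PlusLineCharTwo : Prop :=
  ∀ (W : WeierstrassCurve ℚ) [W.IsElliptic] [W.IsGloballyMinimal], Literature.NumberTheory.EllipticCurves.Rank1Residual.GoodSS W 2 → W.Δ < 0 → ∀ (N' : ℕ), Odd N' → (∀ ℓ : ℕ, ℓ.Prime → ℓ ∣ W.conductorNorm ℤ → ℓ ∣ N') → ∀ (k : Type) [Field k] [CharP k 2] (Ψ₁ Ψ₂ : ℚ → k), (∀ (r : ℚ) (z : ℤ), Ψ₁ (r + z) = Ψ₁ r) → (∀ r : ℚ, Ψ₁ (-r) = Ψ₁ r) → (∀ (γ : CongruenceSubgroup.Gamma0 (N')) (r : ℚ), ((γ : Matrix.SpecialLinearGroup (Fin 2) ℤ) 1 0 : ℚ) * r + ((γ : Matrix.SpecialLinearGroup (Fin 2) ℤ) 1 1 : ℚ) ≠ 0 → Ψ₁ ((((γ : Matrix.SpecialLinearGroup (Fin 2) ℤ) 0 0 : ℚ) * r + ((γ : Matrix.SpecialLinearGroup (Fin 2) ℤ) 0 1 : ℚ)) / (((γ : Matrix.SpecialLinearGroup (Fin 2) ℤ) 1 0 : ℚ) * r + ((γ : Matrix.SpecialLinearGroup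 (Fin 2) ℤ) 1 1 : ℚ))) = (if ((γ : Matrix.SpecialLinearGroup (Fin 2) ℤ) 1 0) = 0 then 0 else Ψ₁ ((((γ : Matrix.SpecialLinearGroup (Fin 2) ℤ) 0 0 : ℚ)) / (((γ : Matrix.SpecialLinearGroup (Fin 2) ℤ) 1 0 : ℚ)))) + Ψ₁ r) → (∀ (r : ℚ) (z : ℤ), Ψ₂ (r + z) = Ψ₂ r) → (∀ r : ℚ, Ψ₂ (-r) = Ψ₂ r) → (∀ (γ : CongruenceSubgroup.Gamma0 (N')) (r : ℚ), ((γ : Matrix.SpecialLinearGroup (Fin 2) ℤ) 1 0 : ℚ) * r + ((γ : Matrix.SpecialLinearGroup (Fin 2) ℤ) 1 1 : ℚ) ≠ 0 → Ψ₂ ((((γ : Matrix.SpecialLinearGroup (Fin 2) ℤ) 0 0 : ℚ) * r + ((γ : Matrix.SpecialLinearGroup (Fin 2) ℤ) 0 1 : ℚ)) / (((γ : Matrix.SpecialLinearGroup (Fin 2) ℤ) 1 0 : ℚ) * r + ((γ : Matrix.SpecialLinearGroup (Fin 2) ℤ) 1 1 : ℚ))) = (if ((γ : Matrix.SpecialLinearGroup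 (Fin 2) ℤ) 1 0) = 0 then 0 else Ψ₂ ((((γ : Matrix.SpecialLinearGroup (Fin 2) ℤ) 0 0 : ℚ)) / (((γ : Matrix.SpecialLinearGroup (Fin 2) ℤ) 1 0 : ℚ)))) + Ψ₂ r) → (∃ r : ℚ, Ψ₁ r ≠ 0) → (∃ r : ℚ, Ψ₂ r ≠ 0) → (∀ q : ℕ, q.Prime → ¬ q ∣ N' → ∀ r : ℚ, (∑ j : Fin q, Ψ₁ ((r + j) / q)) + Ψ₁ (q * r) = (W.LFunction q : k) * Ψ₁ r) → (∀ q : ℕ, q.Prime → ¬ q ∣ N' → ∀ r : ℚ, (∑ j : Fin q, Ψ₂ ((r + j) / q)) + Ψ₂ (q * r) = (W.LFunction q : k) * Ψ₂ r) → (∀ ℓ : ℕ, ℓ.Prime → ℓ ∣ N' → ∀ r : ℚ, ∑ j : Fin ℓ, Ψ₁ ((r + j) / ℓ) = 0) → (∀ ℓ : ℕ, ℓ.Prime → ℓ ∣ N' → ∀ r : ℚ, ∑ j : Fin ℓ, Ψ₂ ((r + j) / ℓ) = 0) → ∃ c : k, ∀ r : ℚ, Ψ₂ r = c * Ψ₁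 r

/-- Child 2 (μ-W₁) `CurveDepletedSymbolMaxAtTwoPowerCusp` — route spelling of `stub_curveDepletedSymbolMaxAtTwoPowerCusp`. -/
def CurveDepletedSymbolMaxAtTwoPowerCusp : Prop :=
  ∀ (W : WeierstrassCurve ℚ) [W.IsElliptic] [W.IsGloballyMinimal], ¬ W.HasCM → W.analyticRank = 0 → Literature.NumberTheory.EllipticCurves.Rank1Residual.GoodSS W 2 → W.frobeniusTrace 2 = 0 → W.Δ < 0 → ∀ [NeZero (W.conductorNorm ℤ)] (f : CuspForm (CongruenceSubgroup.Gamma0 (W.conductorNorm ℤ)) 2), Literature.NumberTheory.EllipticCurves.ModularForms.IsNewformOf W f → ∀ (S₀ : Finset (IsDedekindDomain.HeightOneSpectrum (NumberField.RingOfIntegers ℚ))), (∀ v ∈ S₀, ((2 : ℕ) : NumberField.RingOfIntegers ℚ) ∉ v.asIdeal) → (∀ v : IsDedekindDomain.HeightOneSpectrum (NumberField.RingOfIntegers ℚ), ¬ W.HasGoodReductionAt v → v ∈ S₀) → ∃ n₁ : ℕ, Even n₁ ∧ ∃ s : ZMod (2 ^ n₁), ∀ r : ℚ, ‖(∑ k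 ∈ Fintype.piFinset (fun _ : S₀ ↦ Finset.range 3), (∏ v : S₀, ((W.localPolynomialAt (v : IsDedekindDomain.HeightOneSpectrum (NumberField.RingOfIntegers ℚ))).map (Int.castRingHom (PadicAlgCl 2))).coeff (k v) * ((Rat.HeightOneSpectrum.natGenerator (v : IsDedekindDomain.HeightOneSpectrum (NumberField.RingOfIntegers ℚ)) : PadicAlgCl 2)⁻¹) ^ (k v)) * algebraMap ℚ (PadicAlgCl 2) (Literature.NumberTheory.EllipticCurves.ratPlusSymbol f (r * ((∏ v : S₀, Rat.HeightOneSpectrum.natGenerator (v : IsDedekindDomain.HeightOneSpectrum (NumberField.RingOfIntegers ℚ)) ^ (k v) : ℕ) : ℚ))))‖ ≤ ‖(∑ k ∈ Fintype.piFinset (fun _ : S₀ ↦ Finset.range 3), (∏ v : S₀, ((W.localPolynomialAt (v : IsDedekindDomain.HeightOneSpectrum (NumberField.RingOfIntegers ℚ))).map (Int.castRingHom (PadicAlgCl 2))).coeff (k v) * ((Rat.HeightOneSpectrum.natGenerator (v : IsDedekindDomain.HeightOneSpectrum (NumberField.RingOfIntegers ℚ)) : PadicAlgCl 2)⁻¹)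 ^ (k v)) * algebraMap ℚ (PadicAlgCl 2) (Literature.NumberTheory.EllipticCurves.ratPlusSymbol f ((((((Literature.NumberTheory.EllipticCurves.cyclotomicGenerator 2 : ZMod (2 ^ (n₁ + 2))) ^ s.val).val : ℚ) / (2 : ℚ) ^ (n₁ + 2))) * ((∏ v : S₀, Rat.HeightOneSpectrum.natGenerator (v : IsDedekindDomain.HeightOneSpectrum (NumberField.RingOfIntegers ℚ)) ^ (k v) : ℕ) : ℚ))))‖

/-- Child 3 (D) `DeligneHeckeEigenvalueBound` — the Literature named fact by name (PUB alias). -/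
def DeligneHeckeEigenvalueBound : Prop :=
  Literature.NumberTheory.EllipticCurves.ModularForms.Deligne1974_heckeT_eigenvalue_norm_le

/-- Certificate: child 1 is the registered stub (C3k) verbatim (definitional). -/
example : PlusLineCharTwo = (∀ (W : WeierstrassCurve ℚ) [W.IsElliptic] [W.IsGloballyMinimal], Literature.NumberTheory.EllipticCurves.Rank1Residual.GoodSS W 2 → W.Δ < 0 → ∀ (N' : ℕ), Odd N' → (∀ ℓ : ℕ, ℓ.Prime → ℓ ∣ W.conductorNorm ℤ → ℓ ∣ N') → ∀ (k : Type) [Field k] [CharP k 2] (Ψ₁ Ψ₂ : ℚ → k), (∀ (r : ℚ) (z : ℤ), Ψ₁ (r + z) = Ψ₁ r) → (∀ r : ℚ, Ψ₁ (-r) = Ψ₁ r) → (∀ (γ : CongruenceSubgroup.Gamma0 (N')) (r : ℚ), ((γ : Matrix.SpecialLinearGroup (Fin 2) ℤ) 1 0 : ℚ) * r + ((γ : Matrix.SpecialLinearGroup (Fin 2) ℤ) 1 1 : ℚ) ≠ 0 → Ψ₁ ((((γ : Matrix.SpecialLinearGroup (Fin 2) ℤ) 0 0 : ℚ) * r + ((γ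 : Matrix.SpecialLinearGroup (Fin 2) ℤ) 0 1 : ℚ)) / (((γ : Matrix.SpecialLinearGroup (Fin 2) ℤ) 1 0 : ℚ) * r + ((γ : Matrix.SpecialLinearGroup (Fin 2) ℤ) 1 1 : ℚ))) = (if ((γ : Matrix.SpecialLinearGroup (Fin 2) ℤ) 1 0) = 0 then 0 else Ψ₁ ((((γ : Matrix.SpecialLinearGroup (Fin 2) ℤ) 0 0 : ℚ)) / (((γ : Matrix.SpecialLinearGroup (Fin 2) ℤ) 1 0 : ℚ)))) + Ψ₁ r) → (∀ (r : ℚ) (z : ℤ), Ψ₂ (r + z) = Ψ₂ r) → (∀ r : ℚ, Ψ₂ (-r) = Ψ₂ r) → (∀ (γ : CongruenceSubgroup.Gamma0 (N')) (r : ℚ), ((γ : Matrix.SpecialLinearGroup (Fin 2) ℤ) 1 0 : ℚ) * r + ((γ : Matrix.SpecialLinearGroup (Fin 2) ℤ) 1 1 : ℚ) ≠ 0 → Ψ₂ ((((γ : Matrix.SpecialLinearGroup (Fin 2) ℤ) 0 0 : ℚ) * r + ((γ : Matrix.SpecialLinearGroup (Fin 2) ℤ) 0 1 : ℚ)) / (((γ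 : Matrix.SpecialLinearGroup (Fin 2) ℤ) 1 0 : ℚ) * r + ((γ : Matrix.SpecialLinearGroup (Fin 2) ℤ) 1 1 : ℚ))) = (if ((γ : Matrix.SpecialLinearGroup (Fin 2) ℤ) 1 0) = 0 then 0 else Ψ₂ ((((γ : Matrix.SpecialLinearGroup (Fin 2) ℤ) 0 0 : ℚ)) / (((γ : Matrix.SpecialLinearGroup (Fin 2) ℤ) 1 0 : ℚ)))) + Ψ₂ r) → (∃ r : ℚ, Ψ₁ r ≠ 0) → (∃ r : ℚ, Ψ₂ r ≠ 0) → (∀ q : ℕ, q.Prime → ¬ q ∣ N' → ∀ r : ℚ, (∑ j : Fin q, Ψ₁ ((r + j) / q)) + Ψ₁ (q * r) = (W.LFunction q : k) * Ψ₁ r) → (∀ q : ℕ, q.Prime → ¬ q ∣ N' → ∀ r : ℚ, (∑ j : Fin q, Ψ₂ ((r + j) / q)) + Ψ₂ (q * r) = (W.LFunction q : k) * Ψ₂ r) → (∀ ℓ : ℕ, ℓ.Prime → ℓ ∣ N' → ∀ r : ℚ, ∑ j : Fin ℓ, Ψ₁ ((r + j) / ℓ) = 0) → (∀ ℓ : ℕ,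 ℓ.Prime → ℓ ∣ N' → ∀ r : ℚ, ∑ j : Fin ℓ, Ψ₂ ((r + j) / ℓ) = 0) → ∃ c : k, ∀ r : ℚ, Ψ₂ r = c * Ψ₁ r) := rfl

/-- Certificate: the three children imply the crux BY NAME (landed glue, std axioms). -/
example (h₁ : PlusLineCharTwo) (h₂ : CurveDepletedSymbolMaxAtTwoPowerCusp) (h₃ : DeligneHeckeEigenvalueBound) :
    Summit.BirchSwinnertonDyer.BirchSwinnertonDyer.Theses.ResidualThetaTransportAtTwo.ThetaLayerLambdaCongruenceAtTwo :=
  Summit.BirchSwinnertonDyer.BirchSwinnertonDyer.Theorems.ThetaLayerLambdaCongruenceAtTwo.thetaLayerLambdaCongruenceAtTwo_of_charTwo_curveMax_deligne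
    h₁ h₂ h₃

end Summit.BirchSwinnertonDyer.BirchSwinnertonDyer.Cruxes.ThetaLayerLambdaCongruenceAtTwo.SplitV9
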